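import Summits.ResolutionOfSingularities.ResolutionOfSingularities.Theorems.EquisingularLiftEquisingularLiftNatTowerSideFacts
import Summits.ResolutionOfSingularities.ResolutionOfSingularities.Theorems.EquisingularLiftEquisingularLiftNatInvStepSingular
import Summits.ResolutionOfSingularities.ResolutionOfSingularities.Theorems.EquisingularLiftEquisingularLiftNatRegularPointStepExact
import Literature.AlgebraicGeometry.Resolution.BlowupExceptionalFibreIrreducible
import Literature.AlgebraicGeometry.Resolution.PermissibleCentres
import Literature.AlgebraicGeometry.Resolution.StalkIdealLemmas
import Literature.AlgebraicGeometry.Resolution.ResolutionOfComponentsRegularLocus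
import HarnessLib

/-!
# [OURS · L1 W4.5(b) · EL♮(3) · T23-A″-S] THE DOWNSTAIRS SIDE FACTS OF THE SEEDED PLANE `S` carried next to `TCPlus.InvS` / `InvS₀` in the
# S-arms of V10‴ (`hsub_reachTowerBDoublePrimeS_of_fact`, res-L1-w45b-stub-4): `IsClosed S`, `Z ⊆ S`, `S ⊆ closure (S ∖ closure Z)`, `¬ T ⊆ S`
# (and `IsIrreducible S`) at the SEED `S₂ := υ⁻¹{x}` and through the two in-carrier POINT STEPS; the curve step's inputs of
# `Tower.invB_of_invS_curveStep(_FE)` (…NatTowerCurveStepBS p618350) read off them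

res-type-027 g18 (desk DEAL 2026-08-28T09:01:29Z «`…NatPlaneSideFacts` → res-type-027»; T23-A″-S, res-L1-w45b-stub-4 «R-b» word 08:56:25Z).
Crux `EquisingularLiftNatThree` = stmt-ResolutionOfSingularities-20148 (parent stmt-…-20038), route `EquisingularLift`, line `sections`. OURS; NOT a
statement of any manuscript ([Hironaka2017] is a candidate under adjudication, nothing of it is asserted); AI-written, weaker than expert review.
No `sorry`; standard axioms; DEF-FREE; pure topology + two tree facts about blow-ups. `--supports stmt-ResolutionOfSingularities-20148 --as helper`.

WHAT (downstairs only; the S-side conjunct of V10‴'s inner motive is `IsClosed S ∧ Z ⊆ S ∧ S ⊆ closure (S ∖ closure Z) ∧ ¬ T ⊆ S`):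
* `subset_closure_diff_of_isIrreducible` — an irreducible set not inside a closed `B` is the closure of its part off `B` (topology);
* `maximalIdeal_ne_bot_of_isBlowup_point` / `isIrreducible_preimage_singleton_of_isBlowup_point` — for the blow-up `υ` of the reduced closed point
  `x` with `𝒪_{F₁,x}` regular and a point over `x`: `𝔪_x ≠ ⊥` (the exceptional ideal is an effective Cartier divisor) and the exceptional fibre
  `υ⁻¹{x}` is IRREDUCIBLE (Literature `IsBlowup.isIrreducible_preimage_singleton`: it is a `ℙ^{m-1}`);
* **`plane_seed_sideFacts`** — at the seed (`S₂ := υ⁻¹{x}`, `Z₂ := υ⁻¹{x} ∩ St_x W`, `T₂ := St_x T₁`; inputs `hnot : ¬ υ⁻¹{x} ⊆ St_x W`, `𝒪_{F₁,x}`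
  regular, `IsIrreducible T₂`): `IsClosed S₂ ∧ Z₂ ⊆ S₂ ∧ IsIrreducible S₂ ∧ S₂ ⊆ closure (S₂ ∖ closure Z₂) ∧ ¬ T₂ ⊆ S₂`;
* **`plane_step_sideFacts`** — through the blow-up `υ₁` of a closed point `y ∈ closure Z` (both in-carrier point steps; every set steps as
  `A ↦ closure υ₁⁻¹(A ∖ {y})`): `IsClosed S' ∧ Z' ⊆ S' ∧ S' ⊆ closure (S' ∖ closure Z') ∧ ¬ T' ⊆ S'` from the same four facts downstairs — density by
  res-D-pv-029's `closure_preimage_diff_subset_of_isBlowup` (…NatTowerSideFacts, the K-side transport VERBATIM), `¬ T' ⊆ S'` by res-L1-w45b-stub-1's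
  `not_closure_preimage_diff_subset_of_isBlowup_point` (…NatInvStepSingular) since `y ∈ closure Z ⊆ S`;
* `not_closure_preimage_diff_subset_closure_step` — `¬ S ⊆ closure Z ⇒ ¬ S' ⊆ closure Z'` (same lemma, for motives that carry this form);
* `isIrreducible_closure_preimage_diff_singleton` — `IsIrreducible S ∧ ¬ S ⊆ {y} ⇒ IsIrreducible S'` (the blow-up is an open embedding off `y`);
* `subset_closure_diff_of_density_closed` — at the carrier stage: `S₉ ⊆ closure (S₉ ∖ closure Z₉)` with `Z₉` closed is the input
  `S₉ ⊆ closure (S₉ ∖ Z₉)` of `Tower.invB_of_invS_curveStep`.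

References: U. Görtz, T. Wedhorn, *Algebraic Geometry I* (2020), Prop. 13.91 (3) [GortzWedhorn2020]; R. Hartshorne, *Algebraic Geometry* (1977),
II Thm. 8.24 (b) [Hartshorne1977] — through the cited tree files.
-/

set_option linter.dupNamespace false -- mandated namespace `Summit.<Summit>.<Problem>` of this single-conjunct summit

noncomputable section

open CategoryTheory AlgebraicGeometry TopologicalSpace Topology IsLocalRing
open Literature.AlgebraicGeometry.Resolution
open AlgebraicGeometry.Scheme.IdealSheafData

namespace Summit.ResolutionOfSingularities.ResolutionOfSingularities.Cruxes.EquisingularLiftNat.Sections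

/-! ## Elementary topology -/

/-- An irreducible set which is not inside the closed set `B` lies in the closure of its part off `B`. [folklore] -/
theorem subset_closure_diff_of_isIrreducible {α : Type*} [TopologicalSpace α] {A B : Set α} (hA : IsIrreducible A) (hB : IsClosed B)
    (hAB : ¬ A ⊆ B) : A ⊆ closure (A \ B) := by
  have h : A ⊆ B ∪ closure (A \ B) := fun a ha => by
    by_cases hb : a ∈ B
    · exact Or.inl hb
    · exact Or.inr (subset_closure ⟨ha, hb⟩)
  rcases (isPreirreducible_iff_isClosed_union_isClosed.mp hA.isPreirreducible) _ _ hB isClosed_closure h with h' | h'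
  · exact absurd h' hAB
  · exact h'

/-- Density off a closed set in the two spellings: `A ⊆ closure (A ∖ closure B)` iff `A ⊆ closure (A ∖ B)` for `B` closed. [folklore] -/
theorem subset_closure_diff_of_density_closed {α : Type*} [TopologicalSpace α] {A B : Set α} (hB : IsClosed B)
    (h : A ⊆ closure (A \ closure B)) : A ⊆ closure (A \ B) := by
  rwa [hB.closure_eq] at h

/-! ## The exceptional fibre of the blow-up of a reduced regular closed point -/

section Seed

variable {F₁ F₂ : Scheme.{0}} (υ : F₂ ⟶ F₁) {x : F₁} (hx : IsClosed ({x} : Set F₁))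

/-- If the blow-up of the reduced closed point `x` has a point over `x`, then `𝔪_x ≠ ⊥` (the exceptional ideal `𝔪_x·𝒪_{F₂}` is an
EFFECTIVE Cartier divisor: its stalk generator at a point over `x` is a nonzerodivisor, hence non-zero). [folklore] -/
theorem maximalIdeal_ne_bot_of_isBlowup_point (hυ : IsBlowup υ (vanishingIdeal ⟨{x}, hx⟩)) {z : F₂} (hz : υ z = x) :
    maximalIdeal (F₁.presheaf.stalk x) ≠ ⊥ := by
  subst hz
  intro h0
  obtain ⟨u, hu, hspan⟩ := hυ.isEffectiveCartier.exists_stalkIdeal_eq_span z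
  rw [stalkIdeal_comap_eq_map_stalkMap, stalkIdeal_vanishingIdeal_singleton hx, h0, Ideal.map_bot, eq_comm,
    Ideal.span_singleton_eq_bot] at hspan
  rw [hspan] at hu
  exact zero_notMem_nonZeroDivisors hu

/-- **The exceptional fibre `υ⁻¹{x}` of the blow-up of a reduced closed point `x` with `𝒪_{F₁,x}` regular is IRREDUCIBLE** (given a point over
`x`; it is a projective space over `κ(x)`). [cite: Hartshorne1977, II Thm. 8.24 (b)] -/
theorem isIrreducible_preimage_singleton_of_isBlowup_point (hxreg : IsRegularLocalRing (F₁.presheaf.stalk x))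
    (hυ : IsBlowup υ (vanishingIdeal ⟨{x}, hx⟩)) {z : F₂} (hz : υ z = x) : IsIrreducible (υ ⁻¹' {x}) := by
  haveI := hxreg
  exact hυ.isIrreducible_preimage_singleton x (stalkIdeal_vanishingIdeal_singleton hx)
    (maximalIdeal_ne_bot_of_isBlowup_point υ hx hυ hz)

/-- **THE S-SIDE FACTS AT THE SEED** (`S₂ := υ⁻¹{x}`, `Z₂ := υ⁻¹{x} ∩ closure υ⁻¹(W ∖ {x})`, `T₂ := closure υ⁻¹(T₁ ∖ {x})`): closed, contains the
carrier curve, irreducible, dense off the curve (by `hnot`), and not containing the running curve (a point of `υ⁻¹(T₁ ∖ {x})`).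
[cite: Hartshorne1977, II Thm. 8.24 (b)] [OURS · L1 W4.5b · T23-A″-S] side facts of V10‴'s (base) clause; NOT a statement of the manuscript. -/
theorem plane_seed_sideFacts (hxreg : IsRegularLocalRing (F₁.presheaf.stalk x)) (hυ : IsBlowup υ (vanishingIdeal ⟨{x}, hx⟩))
    (W T₁ : Set F₁) (hnot : ¬ (υ ⁻¹' {x} ⊆ closure (υ ⁻¹' (W \ {x})))) (hirr₂ : IsIrreducible (closure (υ ⁻¹' (T₁ \ {x})))) :
    IsClosed (υ ⁻¹' ({x} : Set F₁)) ∧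
      υ ⁻¹' {x} ∩ closure (υ ⁻¹' (W \ {x})) ⊆ υ ⁻¹' {x} ∧
      IsIrreducible (υ ⁻¹' ({x} : Set F₁)) ∧
      υ ⁻¹' {x} ⊆ closure (υ ⁻¹' {x} \ closure (υ ⁻¹' {x} ∩ closure (υ ⁻¹' (W \ {x})))) ∧
      ¬ closure (υ ⁻¹' (T₁ \ {x})) ⊆ υ ⁻¹' {x} := by
  have hEx : IsClosed (υ ⁻¹' ({x} : Set F₁)) := hx.preimage υ.continuous
  have hZ : IsClosed (υ ⁻¹' {x} ∩ closure (υ ⁻¹' (W \ {x}))) := hEx.inter isClosed_closure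
  -- a point over `x` (from `hnot`), hence irreducibility
  obtain ⟨z, hzx, -⟩ := Set.not_subset.mp hnot
  have hirr : IsIrreducible (υ ⁻¹' ({x} : Set F₁)) := isIrreducible_preimage_singleton_of_isBlowup_point υ hx hxreg hυ hzx
  refine ⟨hEx, Set.inter_subset_left, hirr, ?_, ?_⟩
  · -- dense off the curve: the plane is irreducible and not inside `Z₂ ⊆ St_x W`
    rw [hZ.closure_eq]
    exact subset_closure_diff_of_isIrreducible hirr hZ fun h => hnot fun z hz => (h hz).2
  · -- a point of `υ⁻¹(T₁ ∖ {x})` is not over `x`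
    intro hsub
    obtain ⟨y, hyT⟩ := closure_nonempty_iff.mp hirr₂.nonempty
    exact hyT.2 (hsub (subset_closure hyT))

end Seed

/-! ## Through an in-carrier point step -/

section Step

variable {G₁ G₂ : Scheme.{0}} (υ₁ : G₂ ⟶ G₁) {y : G₁} (hy : IsClosed ({y} : Set G₁))

/-- **THE S-SIDE FACTS THROUGH A POINT STEP.** For the blow-up `υ₁` of the reduced closed point `y ∈ closure Z` and closed `S ⊇ Z` dense off
`closure Z` with `¬ T ⊆ S`: the transported sets `A' := closure υ₁⁻¹(A ∖ {y})` satisfy `IsClosed S'`, `Z' ⊆ S'`, `S' ⊆ closure (S' ∖ closure Z')`,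
`¬ T' ⊆ S'`. [cite: GortzWedhorn2020, Prop. 13.91 (3)] [OURS · L1 W4.5b · T23-A″-S] side facts of V10‴'s two (step) clauses; NOT a statement of
the manuscript. -/
theorem plane_step_sideFacts (hυ₁ : IsBlowup υ₁ (vanishingIdeal ⟨{y}, hy⟩)) (T Z S : Set G₁) (hyZ : y ∈ closure Z)
    (hScl : IsClosed S) (hZS : Z ⊆ S) (hSd : S ⊆ closure (S \ closure Z)) (hTS : ¬ T ⊆ S) :
    IsClosed (closure (υ₁ ⁻¹' (S \ {y}))) ∧
      closure (υ₁ ⁻¹' (Z \ {y})) ⊆ closure (υ₁ ⁻¹' (S \ {y})) ∧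
      closure (υ₁ ⁻¹' (S \ {y})) ⊆ closure (closure (υ₁ ⁻¹' (S \ {y})) \ closure (closure (υ₁ ⁻¹' (Z \ {y})))) ∧
      ¬ closure (υ₁ ⁻¹' (T \ {y})) ⊆ closure (υ₁ ⁻¹' (S \ {y})) := by
  have hDsupp : (((vanishingIdeal ⟨{y}, hy⟩ : G₁.IdealSheafData)).support : Set G₁) = {y} :=
    Scheme.IdealSheafData.coe_support_vanishingIdeal _
  refine ⟨isClosed_closure, closure_mono (Set.preimage_mono fun z hz => ⟨hZS hz.1, hz.2⟩), ?_, ?_⟩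
  · -- density: the K-side transport verbatim (res-D-pv-029 `closure_preimage_diff_subset_of_isBlowup`)
    have h := closure_preimage_diff_subset_of_isBlowup υ₁ _ hυ₁ S (closure Z) isClosed_closure hSd
    rw [hDsupp] at h
    refine h.trans (closure_mono fun g hg => ⟨hg.1, fun hg' => hg.2 ?_⟩)
    rw [closure_closure] at hg'
    refine closure_mono (Set.preimage_mono ?_) hg'
    intro z hz
    exact ⟨subset_closure hz.1, hz.2⟩
  · -- `¬ T' ⊆ S'`: `y ∈ closure Z ⊆ S = closure S` and `¬ T ⊆ closure S` (res-L1-w45b-stub-1's lemma)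
    have h := not_closure_preimage_diff_subset_of_isBlowup_point υ₁ hy hυ₁ (T := T) (Z := S)
      (by rw [hScl.closure_eq]; exact hTS) (subset_closure ((hScl.closure_subset_iff.mpr hZS) hyZ))
    rwa [closure_closure] at h

/-- `¬ S ⊆ closure Z` steps to `¬ S' ⊆ closure Z'` (for motives carrying this spelling of «the plane is not the curve»). [folklore] -/
theorem not_closure_preimage_diff_subset_closure_step (hυ₁ : IsBlowup υ₁ (vanishingIdeal ⟨{y}, hy⟩)) (Z S : Set G₁)
    (hyZ : y ∈ closure Z) (hSZ : ¬ S ⊆ closure Z) :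
    ¬ closure (υ₁ ⁻¹' (S \ {y})) ⊆ closure (closure (υ₁ ⁻¹' (Z \ {y}))) :=
  not_closure_preimage_diff_subset_of_isBlowup_point υ₁ hy hυ₁ hSZ hyZ

/-- **Irreducibility steps**: if `S` is irreducible and `S ⊄ {y}`, then `closure υ₁⁻¹(S ∖ {y})` is irreducible (the blow-up of `y` is an open
embedding off `y`, and `S ∖ {y}` is dense in `S`). [cite: GortzWedhorn2020, Prop. 13.91 (3)] -/
theorem isIrreducible_closure_preimage_diff_singleton (hυ₁ : IsBlowup υ₁ (vanishingIdeal ⟨{y}, hy⟩)) {S : Set G₁}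
    (hS : IsIrreducible S) (hSy : ¬ S ⊆ {y}) : IsIrreducible (closure (υ₁ ⁻¹' (S \ {y}))) := by
  -- `S ∖ {y}` is irreducible: it is dense in the irreducible `S`
  have hdense : S ⊆ closure (S \ {y}) := subset_closure_diff_of_isIrreducible hS hy hSy
  have hcl : closure (S \ {y}) = closure S :=
    Set.Subset.antisymm (closure_mono fun _ h => h.1) (closure_minimal hdense isClosed_closure)
  have hirr : IsIrreducible (S \ {y}) := isIrreducible_iff_closure.mp (by rw [hcl]; exact isIrreducible_iff_closure.mpr hS)
  -- the open embedding `υ₁⁻¹(G₁ ∖ {y}) → G₁`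
  set U : G₁.Opens := ⟨(((vanishingIdeal ⟨{y}, hy⟩ : G₁.IdealSheafData)).support : Set G₁)ᶜ,
    ((vanishingIdeal ⟨{y}, hy⟩ : G₁.IdealSheafData)).support.isClosed.isOpen_compl⟩ with hU
  have hUy : (U : Set G₁) = {y}ᶜ := by
    rw [hU]; change (((vanishingIdeal ⟨{y}, hy⟩ : G₁.IdealSheafData)).support : Set G₁)ᶜ = {y}ᶜ
    rw [Scheme.IdealSheafData.coe_support_vanishingIdeal]; rfl
  haveI : IsIso (υ₁ ∣_ U) := hυ₁.isIso_morphismRestrict (U := U) disjoint_compl_left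
  have hoe : IsOpenEmbedding ((υ₁ ⁻¹ᵁ U).ι ≫ υ₁) := by
    rw [← morphismRestrict_ι]
    exact ((υ₁ ∣_ U) ≫ U.ι).isOpenEmbedding
  -- its range is `G₁ ∖ {y}`
  have hrange : Set.range ((υ₁ ⁻¹ᵁ U).ι ≫ υ₁) = (U : Set G₁) := by
    rw [← morphismRestrict_ι, Scheme.Hom.comp_base, TopCat.coe_comp, Set.range_comp,
      Set.range_eq_univ.mpr (ConcreteCategory.bijective_of_isIso (υ₁ ∣_ U).base).surjective, Set.image_univ, Scheme.Opens.range_ι]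
  -- the preimage of `S ∖ {y}` under the open embedding is preirreducible, and maps onto `υ₁⁻¹(S ∖ {y})`
  have hpre : IsPreirreducible (((υ₁ ⁻¹ᵁ U).ι ≫ υ₁) ⁻¹' (S \ {y})) :=
    IsPreirreducible.preimage_of_isEmbedding hoe.isEmbedding hirr.isPreirreducible (by
      rw [hrange, hUy]; exact fun s hs => hs.2)
  have himage : (υ₁ ⁻¹ᵁ U).ι '' (((υ₁ ⁻¹ᵁ U).ι ≫ υ₁) ⁻¹' (S \ {y})) = υ₁ ⁻¹' (S \ {y}) := by
    ext z
    constructor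
    · rintro ⟨a, ha, rfl⟩
      rw [Set.mem_preimage, Scheme.Hom.comp_apply] at ha
      exact ha
    · intro hz
      have hzU : z ∈ (υ₁ ⁻¹ᵁ U : Set G₂) := by
        change υ₁ z ∈ (U : Set G₁)
        rw [hUy]; exact hz.2
      obtain ⟨a, rfl⟩ : z ∈ Set.range (υ₁ ⁻¹ᵁ U).ι := by rw [Scheme.Opens.range_ι]; exact hzU
      exact ⟨a, by rw [Set.mem_preimage, Scheme.Hom.comp_apply]; exact hz, rfl⟩
  have hpre' : IsPreirreducible (υ₁ ⁻¹' (S \ {y})) := by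
    rw [← himage]
    exact hpre.image _ (υ₁ ⁻¹ᵁ U).ι.continuous.continuousOn
  -- non-empty: a point of `S ∖ {y}` has a preimage
  obtain ⟨s, hsS, hsy⟩ := Set.not_subset.mp hSy
  obtain ⟨s', hs'⟩ := hυ₁.exists_preimage_of_not_mem_support (z := s)
    (by rw [Scheme.IdealSheafData.coe_support_vanishingIdeal]; exact hsy)
  have hne : (υ₁ ⁻¹' (S \ {y})).Nonempty := ⟨s', show υ₁ s' ∈ S \ {y} by rw [hs']; exact ⟨hsS, hsy⟩⟩
  exact isIrreducible_iff_closure.mpr ⟨hne, hpre'⟩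

end Step

end Summit.ResolutionOfSingularities.ResolutionOfSingularities.Cruxes.EquisingularLiftNat.Sections

end
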